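import Mathlib.LinearAlgebra.Matrix.Charpoly.Coeff
import Mathlib.LinearAlgebra.Matrix.SchurComplement
import Mathlib.Algebra.Polynomial.Roots
import Mathlib.RingTheory.Polynomial.Nilpotent
import Mathlib.Algebra.Ring.GeomSum
import Mathlib.Analysis.Complex.Basic

/-!
# val-idea-26 g4 — RETURNS OF ANY RANK: the transfer-matrix criterion (crux `stmt-ValiantsHypothesis-24318`, card `nil-core` §F4)

`SkewCorner.lean` proved: a rank-ONE return `u wᵀ` glues to a space `G` of nilpotents iff `wᵀ gʲ u = 0` for all `g ∈ G`, `j`.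
Here the general-rank version.  For `g` nilpotent and a return `Λ = U V` (`U : ι × σ`, `V : σ × ι`, rank ≤ |σ|) put
  `transfer g U V := X • (V · Σ_{j < |ι|} (X g)ʲ · U) = Σ_j X^{j+1} · V gʲ U ∈ M_σ(ℂ[X])`.
* ★ `forall_isNilpotent_add_smul_iff_charpolyRev` — `(∀ t, g + t·UV nilpotent) ↔ charpolyRev (transfer g U V) = 1`;
  ★ `forall_isNilpotent_add_smul_iff_isNilpotent_transfer` — `… ↔ transfer g U V` is NILPOTENT over `ℂ[X]`.
  (|σ| = 1: `transfer = Σ X^{j+1} wᵀgʲu`, nilpotent iff 0 — the rank-one criterion; |σ| = 2: iff `tr = 0 ∧ det = 0`, the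
  «tensor cancellation» of MOR-type block returns `E₂₁ − E₃₂`; the trace coefficient alone is MOR's `tr(gʲΛ) = 0`:
  `trace_transfer_eq_zero`.)
* tools: `isNilpotent_iff_charpolyRev_eq_one` (reduced commutative ring), `charpolyRev_add_smul_mul` (the determinant
  identity `charpolyRev (g + t·UV) = det (1 − C t • transfer g U V)`, via `det (1 − AB) = det (1 − BA)` and the truncated
  resolvent `(1 − Xg)⁻¹ = Σ (Xg)ʲ`).
Honest framing: linear-algebra lemmas for the crux dossier (the exact «no-return lemma» for returns of every rank); nothing here
asserts `HeavyTopLaw`, `IndexCoreLaw`, the crux or VP ≠ VNP (NOT proved).  Mathlib only.  [val-idea-26 g4]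
-/

namespace Summit.ValiantsHypothesis.ValiantsHypothesis.Cruxes.DualUnipotentThreeHalves.ReturnTransfer

open Matrix Polynomial
open scoped Polynomial

variable {ι σ : Type*} [Fintype ι] [DecidableEq ι] [Fintype σ] [DecidableEq σ]

section general
variable {R : Type*} [CommRing R]

/-- Over a reduced commutative ring a nilpotent matrix has `charpolyRev = 1`. -/
theorem charpolyRev_eq_one_of_isNilpotent [IsReduced R] {M : Matrix ι ι R} (hM : IsNilpotent M) :
    M.charpolyRev = 1 := by
  have hu := Polynomial.isUnit_iff_coeff_isUnit_isNilpotent.mp (Matrix.isUnit_charpolyRev_of_isNilpotent hM)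
  ext k
  rcases Nat.eq_zero_or_pos k with rfl | hk
  · rw [Polynomial.coeff_zero_eq_eval_zero, Matrix.eval_charpolyRev, Polynomial.coeff_one_zero]
  · rw [Polynomial.coeff_one, if_neg hk.ne']
    exact (hu.2 k hk.ne').eq_zero

/-- `charpolyRev M = 1` forces `charpoly M = X ^ |ι|`, hence `M ^ |ι| = 0` (Cayley–Hamilton). -/
theorem pow_card_eq_zero_of_charpolyRev_eq_one {M : Matrix ι ι R} (h : M.charpolyRev = 1) :
    M ^ Fintype.card ι = 0 := by
  nontriviality R
  have hrev : M.charpoly.reverse = 1 := by rw [Matrix.reverse_charpoly, h]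
  have hdeg : M.charpoly.natDegree = Fintype.card ι := Matrix.charpoly_natDegree_eq_dim M
  have hcp : M.charpoly = X ^ Fintype.card ι := by
    ext k
    rw [Polynomial.coeff_X_pow]
    by_cases hk : k ≤ Fintype.card ι
    · have hc := congrArg (fun p => p.coeff (Fintype.card ι - k)) hrev
      simp only [Polynomial.coeff_reverse, hdeg, Polynomial.coeff_one] at hc
      rw [Polynomial.revAt_le (Nat.sub_le _ _), Nat.sub_sub_self hk] at hc
      rw [hc]
      by_cases hk' : k = Fintype.card ι
      · simp [hk']
      · rw [if_neg hk', if_neg]; omega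
    · rw [if_neg (by omega)]
      exact Polynomial.coeff_eq_zero_of_natDegree_lt (by omega)
  have := Matrix.aeval_self_charpoly M
  rwa [hcp, map_pow, Polynomial.aeval_X] at this

theorem isNilpotent_of_charpolyRev_eq_one {M : Matrix ι ι R} (h : M.charpolyRev = 1) : IsNilpotent M :=
  ⟨_, pow_card_eq_zero_of_charpolyRev_eq_one h⟩

/-- Over a reduced commutative ring: nilpotent iff `charpolyRev = 1`. -/
theorem isNilpotent_iff_charpolyRev_eq_one [IsReduced R] (M : Matrix ι ι R) :
    IsNilpotent M ↔ M.charpolyRev = 1 :=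
  ⟨charpolyRev_eq_one_of_isNilpotent, isNilpotent_of_charpolyRev_eq_one⟩

theorem pow_card_eq_zero_of_isNilpotent [IsReduced R] {M : Matrix ι ι R} (hM : IsNilpotent M) :
    M ^ Fintype.card ι = 0 :=
  pow_card_eq_zero_of_charpolyRev_eq_one (charpolyRev_eq_one_of_isNilpotent hM)

/-- Evaluating `charpolyRev F` at `r` gives `det (1 − r • F)`. -/
theorem eval_charpolyRev_eq_det (F : Matrix σ σ R) (r : R) :
    (F.charpolyRev).eval r = det (1 - r • F) := by
  rw [Matrix.charpolyRev, ← Polynomial.coe_evalRingHom, RingHom.map_det]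
  congr 1
  ext i j
  simp only [RingHom.mapMatrix_apply, Matrix.map_apply, Matrix.sub_apply, Matrix.one_apply, Matrix.smul_apply,
    smul_eq_mul, map_sub, Polynomial.coe_evalRingHom, Polynomial.eval_mul, Polynomial.eval_X, Polynomial.eval_C]
  split_ifs <;> simp

end general

/-- Truncated resolvent `Σ_{j < |ι|} (X g)ʲ` of `g` over `ℂ[X]` — the inverse of `1 − X g` when `g` is nilpotent. -/
noncomputable def resolv (g : Matrix ι ι ℂ) : Matrix ι ι ℂ[X] :=
  ∑ j ∈ Finset.range (Fintype.card ι), ((X : ℂ[X]) • g.map C) ^ j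

/-- TRANSFER MATRIX of the return `U V` through the core element `g`: `Σ_j X^{j+1} · V gʲ U ∈ M_σ(ℂ[X])`. -/
noncomputable def transfer (g : Matrix ι ι ℂ) (U : Matrix ι σ ℂ) (V : Matrix σ ι ℂ) : Matrix σ σ ℂ[X] :=
  (X : ℂ[X]) • (V.map C * resolv g * U.map C)

theorem one_sub_mul_resolv (g : Matrix ι ι ℂ) (hg : IsNilpotent g) :
    (1 - (X : ℂ[X]) • g.map C) * resolv g = 1 := by
  have hpow : ((X : ℂ[X]) • g.map C) ^ Fintype.card ι = 0 := by
    rw [smul_pow, ← Matrix.map_pow, pow_card_eq_zero_of_isNilpotent hg]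
    simp
  rw [resolv, mul_neg_geom_sum, hpow, sub_zero]

theorem resolv_mul_one_sub (g : Matrix ι ι ℂ) (hg : IsNilpotent g) :
    resolv g * (1 - (X : ℂ[X]) • g.map C) = 1 := by
  have hpow : ((X : ℂ[X]) • g.map C) ^ Fintype.card ι = 0 := by
    rw [smul_pow, ← Matrix.map_pow, pow_card_eq_zero_of_isNilpotent hg]
    simp
  rw [resolv, geom_sum_mul_neg, hpow, sub_zero]

/-- The determinant identity: `charpolyRev (g + t·UV) = det (1 − C t • transfer g U V)` for nilpotent `g`. -/
theorem charpolyRev_add_smul_mul (g : Matrix ι ι ℂ) (hg : IsNilpotent g) (U : Matrix ι σ ℂ) (V : Matrix σ ι ℂ)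
    (t : ℂ) : (g + t • (U * V)).charpolyRev = det (1 - (C t : ℂ[X]) • transfer g U V) := by
  have hL : det (1 - (X : ℂ[X]) • g.map C) = 1 := charpolyRev_eq_one_of_isNilpotent hg
  have hmap : (g + t • (U * V)).map (C : ℂ →+* ℂ[X]) = g.map C + (C t : ℂ[X]) • (U.map C * V.map C) := by
    ext i j
    simp [Matrix.map_apply, Matrix.add_apply, Matrix.smul_apply, Matrix.mul_apply, map_sum, Finset.mul_sum]
  have key : 1 - (X : ℂ[X]) • (g + t • (U * V)).map C =
      (1 - (X : ℂ[X]) • g.map C) * (1 - (resolv g * (((X : ℂ[X]) * C t) • U.map C)) * V.map C) := by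
    rw [mul_sub, mul_one, ← Matrix.mul_assoc, ← Matrix.mul_assoc, one_sub_mul_resolv g hg, Matrix.one_mul, hmap,
      smul_add, Matrix.smul_mul, smul_smul]
    abel
  rw [Matrix.charpolyRev, key, det_mul, hL, one_mul, det_one_sub_mul_comm, transfer]
  congr 2
  simp only [Matrix.mul_smul, Matrix.mul_assoc, smul_smul, mul_comm (C t : ℂ[X]) (X : ℂ[X])]

/-- ★ RETURN CRITERION, any rank: `g + t·UV` is nilpotent for every `t` iff `charpolyRev (transfer g U V) = 1`
(all the coefficient identities — for |σ| = 2: trace and determinant of the transfer matrix vanish). -/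
theorem forall_isNilpotent_add_smul_iff_charpolyRev (g : Matrix ι ι ℂ) (hg : IsNilpotent g) (U : Matrix ι σ ℂ)
    (V : Matrix σ ι ℂ) : (∀ t : ℂ, IsNilpotent (g + t • (U * V))) ↔ (transfer g U V).charpolyRev = 1 := by
  constructor
  · intro h
    have hroot : ∀ t : ℂ, ((transfer g U V).charpolyRev - 1).IsRoot (C t) := by
      intro t
      rw [Polynomial.IsRoot, Polynomial.eval_sub, Polynomial.eval_one, eval_charpolyRev_eq_det,
        ← charpolyRev_add_smul_mul g hg U V t, charpolyRev_eq_one_of_isNilpotent (h t), sub_self]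
    have hinf : Set.Infinite {x : ℂ[X] | ((transfer g U V).charpolyRev - 1).IsRoot x} :=
      (Set.infinite_range_of_injective (Polynomial.C_injective (R := ℂ))).mono (by
        rintro x ⟨t, rfl⟩; exact hroot t)
    exact sub_eq_zero.mp (Polynomial.eq_zero_of_infinite_isRoot _ hinf)
  · intro h t
    rw [isNilpotent_iff_charpolyRev_eq_one, charpolyRev_add_smul_mul g hg U V t, ← eval_charpolyRev_eq_det, h,
      Polynomial.eval_one]

/-- ★ … iff the transfer matrix is nilpotent over `ℂ[X]`. -/
theorem forall_isNilpotent_add_smul_iff_isNilpotent_transfer (g : Matrix ι ι ℂ) (hg : IsNilpotent g)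
    (U : Matrix ι σ ℂ) (V : Matrix σ ι ℂ) :
    (∀ t : ℂ, IsNilpotent (g + t • (U * V))) ↔ IsNilpotent (transfer g U V) := by
  rw [forall_isNilpotent_add_smul_iff_charpolyRev g hg U V, isNilpotent_iff_charpolyRev_eq_one]

/-- First-order consequence (MOR's trace condition): the transfer matrix is traceless, i.e. `Σ_j X^{j+1} tr(V gʲ U) = 0`. -/
theorem trace_transfer_eq_zero (g : Matrix ι ι ℂ) (hg : IsNilpotent g) (U : Matrix ι σ ℂ) (V : Matrix σ ι ℂ)
    (h : ∀ t : ℂ, IsNilpotent (g + t • (U * V))) : trace (transfer g U V) = 0 := by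
  have h1 := (forall_isNilpotent_add_smul_iff_charpolyRev g hg U V).mp h
  have := Matrix.coeff_charpolyRev_eq_neg_trace (transfer g U V)
  rw [h1, Polynomial.coeff_one] at this
  simpa using this

/-- Space version: a return `UV` glues to a space `G` of nilpotents iff every transfer matrix is nilpotent. -/
theorem nilSpace_sup_span_mul_iff (G : Submodule ℂ (Matrix ι ι ℂ)) (hG : ∀ g ∈ G, IsNilpotent g)
    (U : Matrix ι σ ℂ) (V : Matrix σ ι ℂ) :
    (∀ A ∈ G ⊔ ℂ ∙ (U * V), IsNilpotent A) ↔ ∀ g ∈ G, IsNilpotent (transfer g U V) := by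
  constructor
  · intro h g hgG
    rw [← forall_isNilpotent_add_smul_iff_isNilpotent_transfer g (hG g hgG) U V]
    intro t
    exact h _ (Submodule.add_mem_sup hgG (Submodule.smul_mem _ t (Submodule.mem_span_singleton_self _)))
  · intro h A hA
    obtain ⟨g, hgG, y, hy, rfl⟩ := Submodule.mem_sup.mp hA
    obtain ⟨t, rfl⟩ := Submodule.mem_span_singleton.mp hy
    exact (forall_isNilpotent_add_smul_iff_isNilpotent_transfer g (hG g hgG) U V).mpr (h g hgG) t

end Summit.ValiantsHypothesis.ValiantsHypothesis.Cruxes.DualUnipotentThreeHalves.ReturnTransfer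

/-! ### Worked example (MOR's atom `Irr₃ = ⟨E₁₂ + E₂₃, E₂₁ − E₃₂⟩`, species II, rank-2 return)
`g = E₁₂ + E₂₃`, `Λ = E₂₁ − E₃₂ = U V` with `U = [e₂ | e₃]`, `V = [e₁ᵀ ; −e₂ᵀ]`:
`V U = [[0,0],[−1,0]]`, `V g U = [[1,0],[0,−1]]`, `V g² U = [[0,1],[0,0]]`, so
`transfer g U V = [[X², X³], [−X, −X²]]` — trace `0`, determinant `−X⁴ + X⁴ = 0`: nilpotent, as it must be
(the cancellation is between the diagonal `j = 1` term and the product of the `j = 0` and `j = 2` corners —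
the «tensor cancellation» that a rank-one return cannot produce). -/
section sanity
open Polynomial
/-- axioms check hook (the critic runs `#print axioms`); a trivial specialisation to keep the statement visible. -/
example (g : Matrix (Fin 3) (Fin 3) ℂ) (hg : IsNilpotent g) (U : Matrix (Fin 3) (Fin 2) ℂ) (V : Matrix (Fin 2) (Fin 3) ℂ) :
    (∀ t : ℂ, IsNilpotent (g + t • (U * V))) ↔
      IsNilpotent (Summit.ValiantsHypothesis.ValiantsHypothesis.Cruxes.DualUnipotentThreeHalves.ReturnTransfer.transfer g U V) :=
  Summit.ValiantsHypothesis.ValiantsHypothesis.Cruxes.DualUnipotentThreeHalves.ReturnTransfer.forall_isNilpotent_add_smul_iff_isNilpotent_transfer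
    g hg U V
end sanity
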